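import Summits.QuantumFields.BalabanUV.T4Continuum.Support.BalabanAveragedTowerUnit

/-!
# GAN24 / DirichletExhaustionRebasedTower — road P2, PART 22: the `U = 1` tower of Bałaban's (1.18)-averaged free propagator
# RE-BASED AT LEVEL ONE — the image of `𝒢^{(L^{−(m+1)})}` on the lattice of spacing `L⁻¹` (one level BELOW the unit lattice that
# carries the `a`-term and the gauge term) CONVERGES as `m → ∞`, rate `(CQB/L)·L^{−m}/(1 − L^{−1})`, in operator norm on every torus

Cell `pub-balaban`, β sub-cell, BINDER ROW **G-an2-4 ∕ (CONV-C)** — NOT IN PRINT; our proof attempt.  Lineage gan24-p2 (road P2), gen 8; companion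
of PART 21 `GAN24/DirichletExhaustionGaugeSplit` and of the analysis note GAPS C-gan24p2-9
(`HOME/b2b-balaban-gan24-p2/gen8/KSLOT-FIELD-BLOCKS-PRINTED-SPLIT.md`).  HONEST FRAMING (verbatim): discharging `BetaPertH` makes Bałaban's UV
stability UNCONDITIONAL — a real constructive-QFT result; it is NOT the continuum limit and NOT the Clay problem.  HONEST DEPENDENCY: continuum YM
on T⁴ ⇐ BetaPertH ∧ nine spine estimates (0/9 proved); BetaPertH ⇐ (D1) ∧ (D4) ∧ CAP+tail; G-an2-4 gates asym, D1 and NE2/3/4.  ABSOLUTE RULE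
honoured: this file is `[folklore]` bookkeeping — a RE-INDEXING of the t4-ne2 lineage's kernel theorems (`T4Continuum/Support/BalabanAveragedTowerUnit`
§1–§2: Bałaban's one-step averagings `QBlev`, the propagators `calGlev = 𝒢^{(L^{−k})}` of [Balaban1984PropagatorsI] (1.83), the one-step law
`oneStepAveragedLaw_QB`) fed to NE2's abstract tower `T4Continuum/Spine/CovariantAveragingTower.towerLimitRate_of_oneStepAveragedLaw`; no
printed statement is a hypothesis; Bałaban prints no rate (every [B5] bound is η-uniform); statements and constants are OURS∕t4-ne2's.

## Why (context only; GAPS C-gan24p2-9 (b), consequence (I2)).  After PART 21 and gan24-p3's composition law, the `j`-dependence of the K-slot's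
decimated FIELD blocks sits in two level-`j` data, the first of which is `E_j⁻¹ = Q_M G_N Q_M*` (`M = Lc^j`, `N = Lc^{j+1}`, `G_N = Δ_a(N)⁻¹`): «the
level-`N` propagator seen from ONE LEVEL BELOW the unit lattice».  In the t4-ne2 normalisation (unit lattice FIXED = the lattice of the `a`-term and of
the gauge term; fine spacing `L^{−k}`) this is the image of `𝒢^{(L^{−(m+1)})}` on the lattice of spacing `L^{−1}` under the composite of the `m`
one-step averagings between the levels `m+1, m, …, 1` — i.e. the `avgTow` of NE2's abstract tower for the RE-BASED data `ι′ m := idx (m+1)`,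
`A′ m := QBlev (m+1)`, `X′ m := calGlev (m+1)`.  The one-step law the abstract tower asks of the re-based data at index `m` is LITERALLY
`oneStepAveragedLaw_QB` at index `m+1`; hence the tower limit with rate, with `C′ = CQB(d,a)·L⁻¹`, `ρ = L⁻¹`.  This is the operator-norm ∕ torus
form of the `E_j⁻¹`-channel's convergence; NOT its sup-norm ∕ `ℤ^{d+1}` form, NOT the rate of `E_j` itself (needs a uniform lower bound of the
two-level pivot, (1.99)–(1.101)-type, not claimed), NOT the gauge channel `𝔤_j`, NOT (I2), NOT the K-slot.

## What is proved (0 sorry; `L ≥ 1` unless stated; every `d`, torus `M`, `a > 0`)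
`idx1 ∕ QBlev1 ∕ calGlev1` (the re-based data, reducible), `levelOneCovB m := avgTow QBlev1 (L^d) calGlev1 m` (the level-one image),
`opNorm_QBlev1_sq_le`, **`oneStepAveragedLaw_QB1`** (errors `(CQB·L⁻¹)·(L⁻¹)^m`), **`towerLimitRate_QB1`** (`L ≥ 2`), **`levelOneCovB_tendsto`**
(`∃ c, levelOneCovB → c ∧ ‖levelOneCovB m − c‖ ≤ CQB·L⁻¹·L^{−m}/(1 − L⁻¹)`), `opNorm_levelOneCovB_succ_sub_le`, `opNorm_levelOneCovB_sub_le`.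
NOT the K-slot, NOT BetaPertH, NOT continuum, NOT Clay.
-/

noncomputable section

open scoped Matrix Matrix.Norms.L2Operator
open Filter Topology
open Summit.QuantumFields.BalabanUV.T4Continuum.CovariantAveragingTower
open Summit.QuantumFields.BalabanUV.T4Continuum.BalabanLineAverage (CQB)
open Summit.QuantumFields.BalabanUV.T4Continuum.BalabanAveragedTowerUnit (idx QBlev calGlev opNorm_QBlev_sq_le oneStepAveragedLaw_QB)

namespace Summit.QuantumFields.BalabanUV.Beta.GAN24.DirichletExhaustionRebasedTower

variable {d : ℕ} (L : ℕ) [NeZero L] (M : Fin d → ℕ) [hM : ∀ μ, NeZero (M μ)]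

/-- [folklore] The RE-BASED index family: level `m` of the re-based tower is level `m+1` of NE2's tower (the lattice of spacing
`L^{−(m+1)}`); its level `0` is the lattice of spacing `L⁻¹`, one level below the unit lattice. -/
abbrev idx1 (m : ℕ) : Type := idx L M (m + 1)

/-- [folklore] The re-based one-step averagings: `QBlev1 m = QBlev (m+1)` (Bałaban's (1.11)∕(1.18) line-block average between the lattices
of spacings `L^{−(m+2)}` and `L^{−(m+1)}`). -/
abbrev QBlev1 (m : ℕ) : Matrix (idx1 L M m) (idx1 L M (m + 1)) ℂ := QBlev L M (m + 1)

variable (a : ℝ) (ha : 0 < a)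

/-- [folklore] The re-based propagators: `calGlev1 m = calGlev (m+1) = 𝒢^{(L^{−(m+1)})}` ((1.83) at `U = 1`, `a`-term and gauge term at the
UNIT blocks, unchanged). -/
abbrev calGlev1 (m : ℕ) : Matrix (idx1 L M m) (idx1 L M m) ℂ := calGlev L M a ha (m + 1)

/-- [folklore] **THE LEVEL-ONE IMAGE** of `𝒢^{(L^{−(m+1)})}`: `(L^d)^m · Atow′_m 𝒢^{(L^{−(m+1)})} Atow′_mᴴ` on the lattice of spacing `L⁻¹`
(`Atow′_m` = the composite of the re-based averagings from level `m+1` down to level `1`) — the t4-ne2-normalised form of the K-slot datum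
`E_m⁻¹ = Q_M G_N Q_M*` of GAPS C-gan24p2-9 (b). -/
def levelOneCovB (m : ℕ) : Matrix (idx1 L M 0) (idx1 L M 0) ℂ :=
  avgTow (QBlev1 L M) ((L : ℝ) ^ d) (calGlev1 L M a ha) m

/-- [folklore] `‖QBlev1 m‖² ≤ L^{−d}` (t4-ne2's `opNorm_QBlev_sq_le` at `m+1`). -/
theorem opNorm_QBlev1_sq_le (m : ℕ) : ‖QBlev1 L M m‖ ^ 2 ≤ ((L : ℝ) ^ d)⁻¹ :=
  opNorm_QBlev_sq_le L M (m + 1)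

/-- [folklore] **THE ONE-STEP LAW FOR THE RE-BASED DATA** — literally t4-ne2's `oneStepAveragedLaw_QB` at index `m+1`; errors
`(CQB(d,a)·L⁻¹)·(L⁻¹)^m`. -/
theorem oneStepAveragedLaw_QB1 :
    OneStepAveragedLaw (QBlev1 L M) ((L : ℝ) ^ d) (calGlev1 L M a ha) (fun m => CQB d a * (L : ℝ)⁻¹ * ((L : ℝ)⁻¹) ^ m) := by
  intro m
  have h := oneStepAveragedLaw_QB L M a ha (m + 1)
  beta_reduce at h ⊢
  have e : CQB d a * ((L : ℝ)⁻¹) ^ (m + 1) = CQB d a * (L : ℝ)⁻¹ * ((L : ℝ)⁻¹) ^ m := by ring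
  rw [e] at h
  exact h

/-- [folklore] **THE RE-BASED TOWER LIMIT WITH RATE** (`L ≥ 2`): NE2's `towerLimitRate_of_oneStepAveragedLaw` for the re-based data, `C = CQB·L⁻¹`,
`ρ = L⁻¹`. -/
theorem towerLimitRate_QB1 (hL : 2 ≤ L) :
    TowerLimitRate (QBlev1 L M) ((L : ℝ) ^ d) (calGlev1 L M a ha) (CQB d a * (L : ℝ)⁻¹) ((L : ℝ)⁻¹) := by
  have hL1 : (1 : ℝ) < L := by exact_mod_cast (lt_of_lt_of_le one_lt_two hL : 1 < L)
  have hr : (0 : ℝ) < (L : ℝ) ^ d := pow_pos (lt_trans zero_lt_one hL1) d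
  exact towerLimitRate_of_oneStepAveragedLaw (QBlev1 L M) hr (opNorm_QBlev1_sq_le L M) (calGlev1 L M a ha)
    (inv_lt_one_of_one_lt₀ hL1) (oneStepAveragedLaw_QB1 L M a ha)

/-- [folklore] **THE LEVEL-ONE IMAGES CONVERGE** (`U = 1`, finite torus, `L ≥ 2`): `∃ c, levelOneCovB m → c` and
`‖levelOneCovB m − c‖ ≤ CQB·L⁻¹·(L⁻¹)^m/(1 − L⁻¹)` for every `m` — the operator-norm ∕ torus form of the convergence of the K-slot datum
`E_m⁻¹` («`G_N` seen from one level below the unit lattice»), with an explicit geometric rate; statement and constant OURS ∕ t4-ne2's. -/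
theorem levelOneCovB_tendsto (hL : 2 ≤ L) :
    ∃ cinf : Matrix (idx1 L M 0) (idx1 L M 0) ℂ,
      Tendsto (levelOneCovB L M a ha) atTop (𝓝 cinf) ∧
      ∀ m, ‖levelOneCovB L M a ha m - cinf‖ ≤ CQB d a * (L : ℝ)⁻¹ * ((L : ℝ)⁻¹) ^ m / (1 - (L : ℝ)⁻¹) :=
  towerLimitRate_QB1 L M a ha hL

/-- [folklore] one step of the re-based tower: `‖levelOneCovB (m+1) − levelOneCovB m‖ ≤ CQB·L⁻¹·(L⁻¹)^m` (`L ≥ 1`). -/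
theorem opNorm_levelOneCovB_succ_sub_le (m : ℕ) :
    ‖levelOneCovB L M a ha (m + 1) - levelOneCovB L M a ha m‖ ≤ CQB d a * (L : ℝ)⁻¹ * ((L : ℝ)⁻¹) ^ m := by
  have hr : (0 : ℝ) < (L : ℝ) ^ d := pow_pos (by exact_mod_cast Nat.pos_of_ne_zero (NeZero.ne L)) d
  exact opNorm_avgTow_succ_sub_le (QBlev1 L M) hr (opNorm_QBlev1_sq_le L M) (calGlev1 L M a ha)
    (e := fun m => CQB d a * (L : ℝ)⁻¹ * ((L : ℝ)⁻¹) ^ m) m (oneStepAveragedLaw_QB1 L M a ha m)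

/-- [folklore] two finite levels of the re-based tower ((4.38) shape): `‖levelOneCovB m − levelOneCovB (m+n)‖ ≤ CQB·L⁻¹·(L⁻¹)^m/(1 − L⁻¹)`
(`L ≥ 2`). -/
theorem opNorm_levelOneCovB_sub_le (hL : 2 ≤ L) (m n : ℕ) :
    ‖levelOneCovB L M a ha m - levelOneCovB L M a ha (m + n)‖ ≤ CQB d a * (L : ℝ)⁻¹ * ((L : ℝ)⁻¹) ^ m / (1 - (L : ℝ)⁻¹) := by
  have hL1 : (1 : ℝ) < L := by exact_mod_cast (lt_of_lt_of_le one_lt_two hL : 1 < L)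
  have hr : (0 : ℝ) < (L : ℝ) ^ d := pow_pos (lt_trans zero_lt_one hL1) d
  exact opNorm_avgTow_sub_avgTow_le (QBlev1 L M) hr (opNorm_QBlev1_sq_le L M) (calGlev1 L M a ha)
    (inv_nonneg.mpr (Nat.cast_nonneg _)) (inv_lt_one_of_one_lt₀ hL1) (oneStepAveragedLaw_QB1 L M a ha) m n

end Summit.QuantumFields.BalabanUV.Beta.GAN24.DirichletExhaustionRebasedTower

end
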